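import Mathlib
import HarnessLib
import Summits.Parity.BatemanHorn.Theses.OneSidedDegreeLadder
import Summits.Parity.BatemanHorn.Theorems.LowerNonlinearGlue

/-!
# Route `OneSidedDegreeLadder`, glue item `UpperNonlinearGlue` (the split, generation 1, of the UPPER leaf
# `UpperNonlinear` = stmt-Parity-25176): `UpperQuadThree → UpperLevelLift → UpperParityLift → UpperNonlinear`

Node «UpperLevelLadder» (decomp-parity lens-1 g6; LEVEL ⊥ PARITY cut of the non-linear upper half of
Bateman–Horn).  On a single-quadratic system (`k = 1`, degree 2, system `![q]`) `UpperLevelLift` consumes the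
grade-3 notch `UpperQuadThree` (after the one-member transport `LowerNonlinearGlue.vec_single_eq` /
`LowerNonlinearGlue.mainTerm_single`, already in the tree) and yields grade 2; on every other non-linear system it
yields grade 2 outright; `UpperParityLift` lifts grade 2 to grade 1 = `UpperNonlinear`, system by system.
Proof = the READY-TO-LAND text of the lens-1 g6 kernel `HOME/decomp-parity-lens-1/g6/UpperLevelLadder.lean`
(`upperNonlinear_of_pieces`, kernel-checked with standard axioms), to be landed by a prover-class hand as
`Summits/Parity/BatemanHorn/Theorems/OneSidedDegreeLadderUpperNonlinearGlue.lean --workitem <UpperNonlinearGlue item>`.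
-/

open Filter Finset Polynomial

open Literature.NumberTheory.Sieve

namespace Summit.Parity.BatemanHorn.Theses.OneSidedDegreeLadder

/-- **`UpperNonlinearGlue` holds**: `UpperQuadThree → UpperLevelLift → UpperParityLift → UpperNonlinear`. -/
theorem upperNonlinearGlue_holds : UpperNonlinearGlue := by
  intro hQ hL hP k f hf hex
  refine hP k f hf hex (hL k f hf hex ?_)
  rintro ⟨rfl, hdeg2⟩ ε hε
  rw [LowerNonlinearGlue.vec_single_eq f] at hf ⊢
  filter_upwards [hQ (f 0) hf (hdeg2 0) ε hε] with x hx
  rwa [LowerNonlinearGlue.mainTerm_single (hdeg2 0)]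

end Summit.Parity.BatemanHorn.Theses.OneSidedDegreeLadder
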